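import Mathlib
import Literature.NumberTheory.Transcendental.SemialgebraicMapsProofs
import Literature.Algebra.Polynomial.RealCubicRoots

/-!
# `TwoTorsionTransfer`: the `2`-torsion translation as a real semialgebraic move (helper file)

Helper file for item stmt-KontsevichZagierPeriods-3413 (`TwoTorsionTransfer`, route HermiteRigidity of
`KontsevichZagierPeriods`); the closing theorem is in `HermiteRigidityTwoTorsionTransfer.lean`.

For `q₂, q₃ ∈ ℚ` with `0 < q₂³ − 27 q₃²` the Weierstrass cubic `f(x) = 4x³ − q₂x − q₃` has three real
roots `e₃ < e₂ < e₁` (`e₁ + e₂ + e₃ = 0`) and `f > 0` exactly on `(e₃, e₂) ∪ (e₁, ∞)`. The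
translation by the `2`-torsion point `(e₂, 0)` of `y² = f(x)`, read on `x`-coordinates, is
`Φ(x) = e₂ + (e₂ − e₁)(e₂ − e₃)/(x − e₂)` (Whittaker–Watson §20.33, "addition of a half-period":
`℘(z + ω₂) = e₂ + (e₂ − e₁)(e₂ − e₃)/(℘(z) − e₂)`). This file proves the real algebra and
semialgebraic geometry of `Φ` needed to run it as ONE move of Kontsevich–Zagier's rule (2):

* `exists_roots`: the three roots in Vieta form `e₃ = −e₁ − e₂`, `q₂ = 4(e₁² + e₁e₂ + e₂²)`,
  `q₃ = −4e₁e₂(e₁ + e₂)` (from `Literature.Algebra.Polynomial.card_roots_eq_three_of_discr_pos`,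
  `Cubic.discr ⟨4, 0, −q₂, −q₃⟩ = 16 (q₂³ − 27q₃²)`);
* `cubic_pos_iff`, `setOf_pos_forall_eq`, `setOf_pos_exists_eq`: the sign of `f` and the two domains
  `{f > 0 ∧ ∀ t > x, f t > 0} = (e₁, ∞)`, `{f > 0 ∧ ∃ t > x, f t < 0} = (e₃, e₂)`;
* `cubic_phi`: the invariance of `dx/y`, `f(Φ(x)) = Φ′(x)² · f(x)`; `phi_phi`: `Φ` is an involution;
  `hasDerivAt_phi`; `image_phi_eq`: `Φ` maps `(e₁, ∞)` onto `(e₃, e₂)`;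
* `phi_semialgebraic`: `Φ` is `ℚ`-semialgebraic on `(e₁, ∞)` although `e₂ ∉ ℚ` in general — its
  graph is the projection (Tarski–Seidenberg, `tarski_seidenberg_real_holds`) of the
  `ℚ`-semialgebraic set `{(x, y, t) | x ∈ σ'', f(t) = 0, 12t² − q₂ < 0, 4(y − t)(x − t) = 12t² − q₂}`
  (`e₂` is the unique root of `f` with `f′ < 0`, and `4(e₂ − e₁)(e₂ − e₃) = f′(e₂) = 12e₂² − q₂`).

Every expression is written out in the coordinates `e₁, e₂` (no definitions are introduced).

References: E. T. Whittaker, G. N. Watson, *A Course of Modern Analysis* (1927), §20.33;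
D. F. Lawden, *Elliptic Functions and Applications* (1989), §6.8; J. Bochnak, M. Coste, M.-F. Roy,
*Real Algebraic Geometry* (1998), §2.2.
-/

noncomputable section

open Set MvPolynomial
open Literature.NumberTheory.Transcendental Literature.ModelTheory.ExponentialFields

namespace Summit.KontsevichZagierPeriods.HermiteRigidity.TwoTorsionTransfer

/-! ### The three real roots of a Weierstrass cubic with positive discriminant -/

/-- **Three real roots in Vieta form.** If `0 < A³ − 27B²` then `4x³ − Ax − B` has three real roots
`−e₁ − e₂ < e₂ < e₁` with `A = 4(e₁² + e₁e₂ + e₂²)` and `B = −4e₁e₂(e₁ + e₂)`, i.e.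
`4x³ − Ax − B = 4(x − e₁)(x − e₂)(x + e₁ + e₂)` (a real cubic with positive discriminant has three
distinct real roots, `Literature.Algebra.Polynomial.card_roots_eq_three_of_discr_pos`, plus Vieta).
[folklore] -/
theorem exists_roots (A B : ℝ) (hdisc : 0 < A ^ 3 - 27 * B ^ 2) :
    ∃ e₁ e₂ : ℝ, e₂ < e₁ ∧ -e₁ - e₂ < e₂ ∧ A = 4 * (e₁ ^ 2 + e₁ * e₂ + e₂ ^ 2) ∧
      B = -4 * e₁ * e₂ * (e₁ + e₂) := by
  classical
  set P : Cubic ℝ := ⟨4, 0, -A, -B⟩ with hP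
  have ha : P.a ≠ 0 := by norm_num [hP]
  have hD : 0 < P.discr := by
    have : P.discr = 16 * (A ^ 3 - 27 * B ^ 2) := by
      simp only [Cubic.discr, hP]; ring
    rw [this]; positivity
  have h3 := Literature.Algebra.Polynomial.card_roots_eq_three_of_discr_pos ha hD
  set s := P.roots.toFinset with hs
  set e : Fin 3 ↪o ℝ := s.orderEmbOfFin h3 with he
  have hmem : ∀ i, e i ∈ s := fun i => Finset.orderEmbOfFin_mem s h3 i
  have hroot : ∀ i, 4 * (e i) ^ 3 - A * (e i) - B = 0 := by
    intro i
    have := hmem i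
    rw [hs, Multiset.mem_toFinset, Cubic.mem_roots_iff (Cubic.ne_zero_of_a_ne_zero ha)] at this
    simp only [hP] at this
    linarith
  have h01 : e 0 < e 1 := e.strictMono (by decide)
  have h12 : e 1 < e 2 := e.strictMono (by decide)
  have ha' := hroot 2
  have hb' := hroot 1
  have hc' := hroot 0
  have k1 : 4 * ((e 2) ^ 2 + (e 2) * (e 1) + (e 1) ^ 2) - A = 0 := by
    have : (e 2 - e 1) * (4 * ((e 2) ^ 2 + (e 2) * (e 1) + (e 1) ^ 2) - A) = 0 := by
      linear_combination ha' - hb'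
    exact (mul_eq_zero.mp this).resolve_left (sub_ne_zero.mpr h12.ne')
  have k2 : 4 * ((e 2) ^ 2 + (e 2) * (e 0) + (e 0) ^ 2) - A = 0 := by
    have : (e 2 - e 0) * (4 * ((e 2) ^ 2 + (e 2) * (e 0) + (e 0) ^ 2) - A) = 0 := by
      linear_combination ha' - hc'
    exact (mul_eq_zero.mp this).resolve_left (sub_ne_zero.mpr (h01.trans h12).ne')
  have k3 : e 2 + e 1 + e 0 = 0 := by
    have : (e 1 - e 0) * (4 * (e 2 + e 1 + e 0)) = 0 := by linear_combination k1 - k2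
    have := (mul_eq_zero.mp this).resolve_left (sub_ne_zero.mpr h01.ne')
    linarith
  refine ⟨e 2, e 1, h12, by linarith, by linarith, ?_⟩
  have hA0 : A = 4 * ((e 2) ^ 2 + (e 2) * (e 1) + (e 1) ^ 2) := by linarith
  rw [hA0] at ha'
  linear_combination -ha'

/-! ### Signs of the factored cubic and the two domains -/

/-- Sign of the factored cubic: for `−e₁ − e₂ < e₂ < e₁`,
`4(x − e₁)(x − e₂)(x + e₁ + e₂) > 0 ↔ x ∈ (−e₁ − e₂, e₂) ∪ (e₁, ∞)`. [folklore] -/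
theorem cubic_pos_iff {e₁ e₂ : ℝ} (h21 : e₂ < e₁) (h32 : -e₁ - e₂ < e₂) (x : ℝ) :
    0 < 4 * (x - e₁) * (x - e₂) * (x + e₁ + e₂) ↔ (-e₁ - e₂ < x ∧ x < e₂) ∨ e₁ < x := by
  constructor
  · intro h
    rcases lt_or_ge e₁ x with h1 | h1
    · exact Or.inr h1
    rcases lt_or_ge x e₂ with h2 | h2
    · rcases lt_or_ge (-e₁ - e₂) x with h3 | h3
      · exact Or.inl ⟨h3, h2⟩
      · exfalso
        have h4 : 0 ≤ 4 * (x - e₁) * (x - e₂) := by nlinarith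
        have : 4 * (x - e₁) * (x - e₂) * (x + e₁ + e₂) ≤ 0 :=
          mul_nonpos_of_nonneg_of_nonpos h4 (by linarith)
        linarith
    · exfalso
      have h4 : 4 * (x - e₁) * (x - e₂) ≤ 0 := by nlinarith
      have : 4 * (x - e₁) * (x - e₂) * (x + e₁ + e₂) ≤ 0 :=
        mul_nonpos_of_nonpos_of_nonneg h4 (by linarith)
      linarith
  · rintro (⟨h1, h2⟩ | h)
    · have a : 0 < e₁ - x := by linarith
      have b : 0 < e₂ - x := by linarith
      have c : 0 < x + e₁ + e₂ := by linarith
      have : 4 * (x - e₁) * (x - e₂) * (x + e₁ + e₂) =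
          4 * (e₁ - x) * (e₂ - x) * (x + e₁ + e₂) := by ring
      rw [this]
      positivity
    · have a : 0 < x - e₁ := by linarith
      have b : 0 < x - e₂ := by linarith
      have c : 0 < x + e₁ + e₂ := by linarith
      positivity

/-- The domain `σ'' = {x | f x > 0 ∧ ∀ t > x, f t > 0}` is the half-line `(e₁, ∞)`. [folklore] -/
theorem setOf_pos_forall_eq {e₁ e₂ : ℝ} (h21 : e₂ < e₁) (h32 : -e₁ - e₂ < e₂) :
    {x : ℝ | 0 < 4 * (x - e₁) * (x - e₂) * (x + e₁ + e₂) ∧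
      ∀ t : ℝ, x < t → 0 < 4 * (t - e₁) * (t - e₂) * (t + e₁ + e₂)} = Ioi e₁ := by
  ext x
  simp only [mem_setOf_eq, mem_Ioi]
  constructor
  · rintro ⟨hx, hall⟩
    by_contra hle
    rcases (not_lt.mp hle).lt_or_eq with hlt | heq
    · have := hall e₁ hlt
      simp at this
    · rw [heq] at hx
      simp at hx
  · intro hx
    exact ⟨(cubic_pos_iff h21 h32 x).mpr (Or.inr hx), fun t ht =>
      (cubic_pos_iff h21 h32 t).mpr (Or.inr (hx.trans ht))⟩

/-- The domain `σ = {x | f x > 0 ∧ ∃ t > x, f t < 0}` is the bounded oval `(e₃, e₂)`. [folklore] -/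
theorem setOf_pos_exists_eq {e₁ e₂ : ℝ} (h21 : e₂ < e₁) (h32 : -e₁ - e₂ < e₂) :
    {x : ℝ | 0 < 4 * (x - e₁) * (x - e₂) * (x + e₁ + e₂) ∧
      ∃ t : ℝ, x < t ∧ 4 * (t - e₁) * (t - e₂) * (t + e₁ + e₂) < 0} = Ioo (-e₁ - e₂) e₂ := by
  ext x
  simp only [mem_setOf_eq, mem_Ioo]
  constructor
  · rintro ⟨hx, t, hxt, ht⟩
    rcases (cubic_pos_iff h21 h32 x).mp hx with h | h
    · exact h
    · exfalso
      have := (cubic_pos_iff h21 h32 t).mpr (Or.inr (h.trans hxt))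
      linarith
  · rintro ⟨h1, h2⟩
    refine ⟨(cubic_pos_iff h21 h32 x).mpr (Or.inl ⟨h1, h2⟩), (e₁ + e₂) / 2, by linarith, ?_⟩
    have a : 0 < e₁ - (e₁ + e₂) / 2 := by linarith
    have b : 0 < (e₁ + e₂) / 2 - e₂ := by linarith
    have c : 0 < (e₁ + e₂) / 2 + e₁ + e₂ := by linarith
    have : 4 * ((e₁ + e₂) / 2 - e₁) * ((e₁ + e₂) / 2 - e₂) * ((e₁ + e₂) / 2 + e₁ + e₂) =
        -(4 * (e₁ - (e₁ + e₂) / 2) * ((e₁ + e₂) / 2 - e₂) * ((e₁ + e₂) / 2 + e₁ + e₂)) := by ring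
    rw [this]
    exact neg_neg_of_pos (by positivity)

/-! ### The `2`-torsion translation `Φ(x) = e₂ + (e₂ − e₁)(e₂ − e₃)/(x − e₂)` -/

/-- **Invariance of `dx/y` under a `2`-torsion translation** (Whittaker–Watson §20.33 differentiated):
with `Φ(x) = e₂ + a/(x − e₂)`, `a = (e₂ − e₁)(e₁ + 2e₂) = (e₂ − e₁)(e₂ − e₃)`, one has
`f(Φ(x)) = Φ′(x)² f(x)`, `Φ′(x) = −a/(x − e₂)²`, for `f(x) = 4(x − e₁)(x − e₂)(x + e₁ + e₂)`.
[cite: WhittakerWatson1927, §20.33] -/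
theorem cubic_phi (e₁ e₂ x : ℝ) (hx : x ≠ e₂) :
    4 * (e₂ + (e₂ - e₁) * (e₁ + 2 * e₂) / (x - e₂) - e₁) *
        (e₂ + (e₂ - e₁) * (e₁ + 2 * e₂) / (x - e₂) - e₂) *
        (e₂ + (e₂ - e₁) * (e₁ + 2 * e₂) / (x - e₂) + e₁ + e₂) =
      (-((e₂ - e₁) * (e₁ + 2 * e₂)) / (x - e₂) ^ 2) ^ 2 *
        (4 * (x - e₁) * (x - e₂) * (x + e₁ + e₂)) := by
  have h : x - e₂ ≠ 0 := sub_ne_zero.mpr hx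
  field_simp
  ring

/-- `Φ` is an involution off `x = e₂` (`(e₂, 0)` is `2`-torsion). [folklore] -/
theorem phi_phi {a e₂ y : ℝ} (ha : a ≠ 0) (hy : y ≠ e₂) :
    e₂ + a / (e₂ + a / (y - e₂) - e₂) = y := by
  have h1 : y - e₂ ≠ 0 := sub_ne_zero.mpr hy
  have h2 : e₂ + a / (y - e₂) - e₂ = a / (y - e₂) := by ring
  rw [h2]
  field_simp
  ring

/-- The derivative of `Φ(x) = e₂ + a/(x − e₂)` is `−a/(x − e₂)²`. [folklore] -/
theorem hasDerivAt_phi (a e₂ x : ℝ) (hx : x ≠ e₂) :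
    HasDerivAt (fun y => e₂ + a / (y - e₂)) (-a / (x - e₂) ^ 2) x := by
  have h0 : x - e₂ ≠ 0 := sub_ne_zero.mpr hx
  have h1 : HasDerivAt (fun y => y - e₂) 1 x := (hasDerivAt_id x).sub_const e₂
  have h2 : HasDerivAt (fun y => (y - e₂)⁻¹) (-(1 : ℝ) / (x - e₂) ^ 2) x := h1.inv h0
  have h3 : HasDerivAt (fun y => e₂ + a * (y - e₂)⁻¹) (a * (-(1 : ℝ) / (x - e₂) ^ 2)) x :=
    (h2.const_mul a).const_add e₂
  have h4 : (fun y : ℝ => e₂ + a / (y - e₂)) = fun y => e₂ + a * (y - e₂)⁻¹ := by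
    funext y
    rw [div_eq_mul_inv]
  rw [h4]
  refine h3.congr_deriv ?_
  ring

/-- On `(e₁, ∞)` the translate `Φ(x)` lies in the oval `(e₃, e₂)`. [folklore] -/
theorem phi_mem_Ioo {e₁ e₂ : ℝ} (h21 : e₂ < e₁) (h32 : -e₁ - e₂ < e₂) {x : ℝ} (hx : e₁ < x) :
    e₂ + (e₂ - e₁) * (e₁ + 2 * e₂) / (x - e₂) ∈ Ioo (-e₁ - e₂) e₂ := by
  have hx2 : 0 < x - e₂ := by linarith
  have ha : (e₂ - e₁) * (e₁ + 2 * e₂) < 0 := mul_neg_of_neg_of_pos (by linarith) (by linarith)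
  constructor
  · have : e₂ + (e₂ - e₁) * (e₁ + 2 * e₂) / (x - e₂) - (-e₁ - e₂) =
        (e₁ + 2 * e₂) * (x - e₁) / (x - e₂) := by
      field_simp
      ring
    have hpos : 0 < (e₁ + 2 * e₂) * (x - e₁) / (x - e₂) :=
      div_pos (mul_pos (by linarith) (by linarith)) hx2
    linarith
  · have : (e₂ - e₁) * (e₁ + 2 * e₂) / (x - e₂) < 0 := div_neg_of_neg_of_pos ha hx2
    linarith

/-- Every point of the oval `(e₃, e₂)` is `Φ(x)` for a (unique) `x > e₁`, namely `x = Φ(y)`.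
[folklore] -/
theorem lt_phi_of_mem_Ioo {e₁ e₂ : ℝ} (h21 : e₂ < e₁) {y : ℝ} (hy : y ∈ Ioo (-e₁ - e₂) e₂) : e₁ < e₂ + (e₂ - e₁) * (e₁ + 2 * e₂) / (y - e₂) := by
  have hy2 : y - e₂ < 0 := by linarith [hy.2]
  have : e₂ + (e₂ - e₁) * (e₁ + 2 * e₂) / (y - e₂) - e₁ =
      (e₂ - e₁) * (y + e₁ + e₂) / (y - e₂) := by
    have : y - e₂ ≠ 0 := hy2.ne
    field_simp
    ring
  have hpos : 0 < (e₂ - e₁) * (y + e₁ + e₂) / (y - e₂) :=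
    div_pos_of_neg_of_neg (mul_neg_of_neg_of_pos (by linarith) (by linarith [hy.1])) hy2
  linarith

/-- The image of `(e₁, ∞)` under `Φ` is exactly the oval `(e₃, e₂)`. [folklore] -/
theorem image_phi_eq {e₁ e₂ : ℝ} (h21 : e₂ < e₁) (h32 : -e₁ - e₂ < e₂) :
    (fun p : Fin 1 → ℝ => fun _ : Fin 1 => e₂ + (e₂ - e₁) * (e₁ + 2 * e₂) / (p 0 - e₂)) ''
        {p : Fin 1 → ℝ | e₁ < p 0} = {p : Fin 1 → ℝ | -e₁ - e₂ < p 0 ∧ p 0 < e₂} := by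
  have ha : (e₂ - e₁) * (e₁ + 2 * e₂) ≠ 0 :=
    (mul_neg_of_neg_of_pos (by linarith) (by linarith)).ne
  ext q
  simp only [mem_image, mem_setOf_eq]
  constructor
  · rintro ⟨p, hp, rfl⟩
    exact phi_mem_Ioo h21 h32 hp
  · rintro hq
    refine ⟨fun _ => e₂ + (e₂ - e₁) * (e₁ + 2 * e₂) / (q 0 - e₂), lt_phi_of_mem_Ioo h21 hq, ?_⟩
    funext i
    rw [Fin.fin_one_eq_zero i]
    exact phi_phi ha hq.2.ne

/-! ### `Φ` is `ℚ`-semialgebraic (one Tarski–Seidenberg projection) -/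

/-- **`Φ` is `ℚ`-semialgebraic on `(e₁, ∞)`.** Although `e₂` is irrational in general, the graph of
`Φ(x) = e₂ + (e₂ − e₁)(e₂ − e₃)/(x − e₂)` over `σ'' = (e₁, ∞)` is the projection forgetting `t` of
the `ℚ`-semialgebraic set `{(x, y, t) | x ∈ σ'', f(t) = 0, 12t² − q₂ < 0, 4(y − t)(x − t) = 12t² − q₂}`
(`e₂` is the unique root of `f` at which `f′ = 12t² − q₂` is negative, and
`f′(e₂) = 4(e₂ − e₁)(e₂ − e₃)`), hence `ℚ`-semialgebraic by the Tarski–Seidenberg theorem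
(`tarski_seidenberg_real_holds`). [cite: BochnakCosteRoy1998, Thm. 2.2.1] -/
theorem phi_semialgebraic {q₂ q₃ : ℚ} {e₁ e₂ : ℝ} (h21 : e₂ < e₁) (h32 : -e₁ - e₂ < e₂)
    (hA : (q₂ : ℝ) = 4 * (e₁ ^ 2 + e₁ * e₂ + e₂ ^ 2)) (hB : (q₃ : ℝ) = -4 * e₁ * e₂ * (e₁ + e₂))
    (hS : IsSemialgebraic ℚ {p : Fin 1 → ℝ | e₁ < p 0}) :
    IsSemialgebraicFunOn ℚ {p : Fin 1 → ℝ | e₁ < p 0}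
      (fun p => e₂ + (e₂ - e₁) * (e₁ + 2 * e₂) / (p 0 - e₂)) := by
  have hf : ∀ t : ℝ, 4 * t ^ 3 - (q₂ : ℝ) * t - (q₃ : ℝ) =
      4 * (t - e₁) * (t - e₂) * (t + e₁ + e₂) := fun t => by
    rw [hA, hB]; ring
  have h12 : 12 * e₂ ^ 2 - (q₂ : ℝ) = 4 * ((e₂ - e₁) * (e₁ + 2 * e₂)) := by rw [hA]; ring
  -- `e₂` is the only root with `f' < 0`
  have hroot : ∀ t : ℝ, 4 * t ^ 3 - (q₂ : ℝ) * t - (q₃ : ℝ) = 0 →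
      12 * t ^ 2 - (q₂ : ℝ) < 0 → t = e₂ := by
    intro t ht ht'
    rw [hf] at ht
    rcases mul_eq_zero.mp ht with h | h
    · rcases mul_eq_zero.mp h with h | h
      · have hte : t = e₁ := by linarith
        rw [hte, hA] at ht'
        nlinarith
      · exact sub_eq_zero.mp h
    · have hte : t = -e₁ - e₂ := by linarith
      rw [hte, hA] at ht'
      nlinarith
  -- the semialgebraic set upstairs
  have hW : IsSemialgebraic ℚ
      ((((fun w : Fin 3 → ℝ => w ∘ fun _ : Fin 1 => (0 : Fin 3)) ⁻¹' {p : Fin 1 → ℝ | e₁ < p 0}) ∩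
        {w : Fin 3 → ℝ | 4 * w 2 ^ 3 - (q₂ : ℝ) * w 2 - (q₃ : ℝ) = 0}) ∩
        {w : Fin 3 → ℝ | 12 * w 2 ^ 2 - (q₂ : ℝ) < 0} ∩
        {w : Fin 3 → ℝ | 4 * (w 1 - w 2) * (w 0 - w 2) - (12 * w 2 ^ 2 - (q₂ : ℝ)) = 0}) := by
    refine (((hS.preimage_comp fun _ : Fin 1 => (0 : Fin 3)).inter ?_).inter ?_).inter ?_
    · convert isSemialgebraic_setOf_eval_eq_zero (k := ℚ) (R := ℝ)
        (4 * X 2 ^ 3 - C q₂ * X 2 - C q₃ : MvPolynomial (Fin 3) ℚ) using 2 with w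
      simp
    · convert isSemialgebraic_setOf_eval_pos (k := ℚ) (R := ℝ)
        (C q₂ - 12 * X 2 ^ 2 : MvPolynomial (Fin 3) ℚ) using 2 with w
      simp only [map_sub, map_mul, map_pow, aeval_X, aeval_C, eq_ratCast, sub_neg, sub_pos]
      norm_num
    · convert isSemialgebraic_setOf_eval_eq_zero (k := ℚ) (R := ℝ)
        (4 * (X 1 - X 2) * (X 0 - X 2) - (12 * X 2 ^ 2 - C q₂) : MvPolynomial (Fin 3) ℚ)
        using 2 with w
      simp
  rw [isSemialgebraicFunOn_iff]
  convert tarski_seidenberg_real_holds hW using 1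
  ext z
  have e0 : Fin.init z 0 = z 0 := rfl
  have e1 : z (Fin.last 1) = z 1 := rfl
  simp only [mem_setOf_eq, mem_image, mem_inter_iff, mem_preimage, e0, e1, Function.comp_apply]
  constructor
  · rintro ⟨hz0, hz1⟩
    refine ⟨Fin.snoc z e₂, ⟨⟨⟨?_, ?_⟩, ?_⟩, ?_⟩, ?_⟩
    · simpa [Fin.snoc] using hz0
    · simp [Fin.snoc, hf]
    · have ha : (e₂ - e₁) * (e₁ + 2 * e₂) < 0 :=
        mul_neg_of_neg_of_pos (by linarith) (by linarith)
      have s2 : (Fin.snoc z e₂ : Fin 3 → ℝ) 2 = e₂ := by simp [Fin.snoc]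
      rw [s2, h12]
      linarith
    · have hx2 : z 0 - e₂ ≠ 0 := by
        have : e₂ < z 0 := h21.trans hz0
        exact (sub_pos.mpr this).ne'
      have s0 : (Fin.snoc z e₂ : Fin 3 → ℝ) 0 = z 0 := by simp [Fin.snoc]
      have s1 : (Fin.snoc z e₂ : Fin 3 → ℝ) 1 = z 1 := by simp [Fin.snoc]
      have s2 : (Fin.snoc z e₂ : Fin 3 → ℝ) 2 = e₂ := by simp [Fin.snoc]
      rw [s0, s1, s2, hz1, h12]
      field_simp
      ring
    · funext i
      simp
  · rintro ⟨w, ⟨⟨⟨hw0, hwr⟩, hwd⟩, hwg⟩, rfl⟩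
    have hw0' : e₁ < w 0 := hw0
    have ht : w 2 = e₂ := hroot _ hwr hwd
    refine ⟨hw0', ?_⟩
    have hx2 : w 0 - e₂ ≠ 0 := by
      have : e₂ < w 0 := h21.trans hw0'
      exact (sub_pos.mpr this).ne'
    rw [ht, h12] at hwg
    have e2 : (w ∘ Fin.castSucc) 1 = w 1 := rfl
    have e3 : (w ∘ Fin.castSucc) 0 = w 0 := rfl
    have key : w 1 - e₂ = (e₂ - e₁) * (e₁ + 2 * e₂) / (w 0 - e₂) := by
      rw [eq_div_iff hx2]
      linear_combination (1 / 4 : ℝ) * hwg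
    rw [e2, e3]
    linarith [key]

end Summit.KontsevichZagierPeriods.HermiteRigidity.TwoTorsionTransfer

end
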